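import Summits.KontsevichZagierPeriods.KontsevichZagierPeriods.Theses.SymplecticScissors
import Summits.KontsevichZagierPeriods.KontsevichZagierPeriods.Theorems.PlanarK0Injective.Negative.Kit
import Literature.NumberTheory.Transcendental.BakerLogarithmsConclusion

/-!
# `PlanarK0Injective` (stmt-KontsevichZagierPeriods-9847) — line `mordell-weil-normal-form`,
stub `stub_toricIndependence`

Target: `Summits/KontsevichZagierPeriods/KontsevichZagierPeriods/Theorems/SymplecticScissorsPlanarK0InjectiveToricIndependence.lean`.
The theorem `stub_toricIndependence` below must keep EXACTLY this signature (registered on the crux item).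

The toric independence certificate of the normal-form line: if `bᵢ > 0` and `βₖ` are real
algebraic numbers and the complex logarithms `log bᵢ`, `i · arctan βₖ` are `ℚ`-linearly
independent, then `1, log bᵢ, arctan βₖ` admit no non-trivial vanishing linear combination with
real algebraic coefficients. This is Baker's theorem (`baker_holds`, Baker 1975, Theorem 2.1,
PROVED in the tree) in real clothes:

* `log bᵢ` is a logarithm of the algebraic number `bᵢ` (`exp (log bᵢ) = bᵢ`), and `i · arctan βₖ`
  is a logarithm of the algebraic number
  `cos (arctan βₖ) + i sin (arctan βₖ) = (1 + iβₖ)/√(1 + βₖ²)`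
  (`toric_isAlgebraic_cexp_log`, `toric_isAlgebraic_cexp_I_mul_arctan`);
* Baker's theorem makes `1, log bᵢ, i · arctan βₖ` linearly independent over `ℚ̄`;
* a real algebraic relation `μ₀ + Σ μᵢ log bᵢ + Σ μₖ arctan βₖ = 0` is the `ℚ̄`-relation with
  coefficients `μ₀, μᵢ, -i μₖ` (`toric_eq_zero_of_linearIndependent`), hence trivial.

## References

* A. Baker, *Transcendental Number Theory*, CUP 1975, Theorem 2.1 (tree: `baker_holds`).
-/

noncomputable section

open MeasureTheory Set
open Literature.NumberTheory.Transcendental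
open Summit.KontsevichZagierPeriods.SymplecticScissors.PlanarK0InjectiveNegative (planarGroup
  eval_eq_zero_of_mem_planarGroup)

namespace Summit.KontsevichZagierPeriods.SymplecticScissors.MordellWeil

/-! ## Algebraicity of the exponentials -/

/-- For a real algebraic `β`, `√(1 + β²)` is algebraic. [folklore] -/
theorem toric_isAlgebraic_sqrt_one_add_sq {β : ℝ} (hβ : IsAlgebraic ℚ β) :
    IsAlgebraic ℚ (Real.sqrt (1 + β ^ 2)) := by
  refine IsAlgebraic.of_pow two_pos ?_
  rw [Real.sq_sqrt (by positivity)]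
  exact isAlgebraic_one.add (hβ.pow 2)

/-- For a real algebraic `β`, `cos (arctan β) = 1 / √(1 + β²)` is algebraic. [folklore] -/
theorem toric_isAlgebraic_cos_arctan {β : ℝ} (hβ : IsAlgebraic ℚ β) :
    IsAlgebraic ℚ (Real.cos (Real.arctan β)) := by
  rw [Real.cos_arctan, one_div]
  exact (toric_isAlgebraic_sqrt_one_add_sq hβ).inv

/-- For a real algebraic `β`, `sin (arctan β) = β / √(1 + β²)` is algebraic. [folklore] -/
theorem toric_isAlgebraic_sin_arctan {β : ℝ} (hβ : IsAlgebraic ℚ β) :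
    IsAlgebraic ℚ (Real.sin (Real.arctan β)) := by
  rw [Real.sin_arctan, div_eq_mul_inv]
  exact hβ.mul (toric_isAlgebraic_sqrt_one_add_sq hβ).inv

/-- `exp (log b) = b` is algebraic for a positive real algebraic `b` (a real algebraic number is
algebraic as a complex number: `isAlgebraic_algebraMap_iff` for the injection `ℝ → ℂ`).
[folklore] -/
theorem toric_isAlgebraic_cexp_log {b : ℝ} (hb : IsAlgebraic ℚ b) (hpos : 0 < b) :
    IsAlgebraic ℚ (Complex.exp ((Real.log b : ℝ) : ℂ)) := by
  rw [← Complex.ofReal_exp, Real.exp_log hpos]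
  exact (isAlgebraic_algebraMap_iff (A := ℂ) Complex.ofReal_injective).mpr hb

/-- `exp (i · arctan β) = cos (arctan β) + sin (arctan β) · i` is algebraic for a real algebraic
`β` (`i` is algebraic: `i² = -1`). [folklore] -/
theorem toric_isAlgebraic_cexp_I_mul_arctan {β : ℝ} (hβ : IsAlgebraic ℚ β) :
    IsAlgebraic ℚ (Complex.exp (Complex.I * ((Real.arctan β : ℝ) : ℂ))) := by
  have hI : IsAlgebraic ℚ Complex.I :=
    IsAlgebraic.of_pow two_pos (by rw [Complex.I_sq]; exact isAlgebraic_one.neg)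
  have ofC : ∀ {x : ℝ}, IsAlgebraic ℚ x → IsAlgebraic ℚ (x : ℂ) := fun hx =>
    (isAlgebraic_algebraMap_iff (A := ℂ) Complex.ofReal_injective).mpr hx
  rw [mul_comm, Complex.exp_mul_I, ← Complex.ofReal_cos, ← Complex.ofReal_sin]
  exact (ofC (toric_isAlgebraic_cos_arctan hβ)).add
    ((ofC (toric_isAlgebraic_sin_arctan hβ)).mul hI)

/-! ## From `ℚ̄`-independence of `1, xᵢ, i yₖ` to real algebraic relations among `1, xᵢ, yₖ` -/

/-- Linear-algebra step: if `1, xᵢ, i · yₖ` (real `xᵢ, yₖ`) are linearly independent over the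
field `ℚ̄ = algebraicClosure ℚ ℂ` of complex algebraic numbers, then every vanishing linear
combination `μ₀ · 1 + Σ μᵢ xᵢ + Σ μₖ yₖ = 0` with real algebraic coefficients is trivial (use the
`ℚ̄`-coefficients `μ₀, μᵢ, -i μₖ`). [folklore] -/
theorem toric_eq_zero_of_linearIndependent {p q : ℕ} (x : Fin p → ℝ) (y : Fin q → ℝ)
    (h : LinearIndependent (algebraicClosure ℚ ℂ) fun o : Option (Fin p ⊕ Fin q) =>
      o.elim (1 : ℂ) (Sum.elim (fun i => ((x i : ℝ) : ℂ)) (fun k => Complex.I * ((y k : ℝ) : ℂ))))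
    (μ : Unit ⊕ (Fin p ⊕ Fin q) → ℝ) (hμ : ∀ j, IsAlgebraic ℚ (μ j))
    (hsum : ∑ j, μ j * Sum.elim (fun _ => (1 : ℝ)) (Sum.elim x y) j = 0) :
    ∀ j, μ j = 0 := by
  classical
  -- real algebraic numbers, and `-i` times them, as elements of `ℚ̄ ⊆ ℂ`
  have memK : ∀ {c : ℝ}, IsAlgebraic ℚ c → (c : ℂ) ∈ algebraicClosure ℚ ℂ := fun hc =>
    mem_algebraicClosure_iff.mpr
      ((isAlgebraic_algebraMap_iff (A := ℂ) Complex.ofReal_injective).mpr hc)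
  have hI : IsAlgebraic ℚ Complex.I :=
    IsAlgebraic.of_pow two_pos (by rw [Complex.I_sq]; exact isAlgebraic_one.neg)
  have memKI : ∀ {c : ℝ}, IsAlgebraic ℚ c → -Complex.I * (c : ℂ) ∈ algebraicClosure ℚ ℂ :=
    fun hc => mul_mem (neg_mem (mem_algebraicClosure_iff.mpr hI)) (memK hc)
  have hsum' : μ (Sum.inl ()) + (∑ i, μ (Sum.inr (Sum.inl i)) * x i +
      ∑ k, μ (Sum.inr (Sum.inr k)) * y k) = 0 := by
    simpa [Fintype.sum_sum_type] using hsum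
  -- the same relation, read in `ℂ`
  have hC : ((μ (Sum.inl ()) : ℝ) : ℂ) +
      (∑ i, ((μ (Sum.inr (Sum.inl i)) : ℝ) : ℂ) * ((x i : ℝ) : ℂ) +
        ∑ k, ((μ (Sum.inr (Sum.inr k)) : ℝ) : ℂ) * ((y k : ℝ) : ℂ)) = 0 := by
    have := congrArg (fun r : ℝ => (r : ℂ)) hsum'
    simpa only [Complex.ofReal_add, Complex.ofReal_sum, Complex.ofReal_mul,
      Complex.ofReal_zero] using this
  -- coefficients in `ℚ̄`
  let g : Option (Fin p ⊕ Fin q) → algebraicClosure ℚ ℂ := fun o =>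
    o.elim ⟨((μ (Sum.inl ()) : ℝ) : ℂ), memK (hμ _)⟩
      (Sum.elim (fun i => ⟨((μ (Sum.inr (Sum.inl i)) : ℝ) : ℂ), memK (hμ _)⟩)
        (fun k => ⟨-Complex.I * ((μ (Sum.inr (Sum.inr k)) : ℝ) : ℂ), memKI (hμ _)⟩))
  have hg : ∑ o, g o • (o.elim (1 : ℂ) (Sum.elim (fun i => ((x i : ℝ) : ℂ))
      (fun k => Complex.I * ((y k : ℝ) : ℂ)))) = 0 := by
    rw [Fintype.sum_option, Fintype.sum_sum_type]
    simp only [g, Option.elim_none, Option.elim_some, Sum.elim_inl, Sum.elim_inr,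
      IntermediateField.smul_def, smul_eq_mul, mul_one]
    have hk : ∀ k,
        -Complex.I * ((μ (Sum.inr (Sum.inr k)) : ℝ) : ℂ) * (Complex.I * ((y k : ℝ) : ℂ)) =
          ((μ (Sum.inr (Sum.inr k)) : ℝ) : ℂ) * ((y k : ℝ) : ℂ) := fun k => by
      linear_combination
        (-(((μ (Sum.inr (Sum.inr k)) : ℝ) : ℂ) * ((y k : ℝ) : ℂ))) * Complex.I_sq
    simp only [hk]
    exact hC
  have hg0 := Fintype.linearIndependent_iff.mp h g hg
  rintro (u | i | k)
  · have h0 := congrArg (fun w : algebraicClosure ℚ ℂ => (w : ℂ)) (hg0 none)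
    simpa [g] using h0
  · have h0 := congrArg (fun w : algebraicClosure ℚ ℂ => (w : ℂ)) (hg0 (some (Sum.inl i)))
    simpa [g] using h0
  · have h0 := congrArg (fun w : algebraicClosure ℚ ℂ => (w : ℂ)) (hg0 (some (Sum.inr k)))
    simpa [g] using h0

/-! ## The stub -/

/-- **Stub 4 (toric independence = Baker's theorem in real clothes).** If `bᵢ > 0` and `βₖ` are
real algebraic numbers such that the complex logarithms `log bᵢ`, `i · arctan βₖ` (logarithms of
the algebraic numbers `bᵢ` and `(1 + iβₖ)/√(1 + βₖ²)`) are `ℚ`-linearly independent, then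
`1, log bᵢ, arctan βₖ` admit no non-trivial vanishing linear combination with real algebraic
coefficients. [cite: Baker1975, Theorem 2.1] -/
theorem stub_toricIndependence :
    ∀ (p q : ℕ) (b : Fin p → ℝ) (β : Fin q → ℝ), (∀ i, IsAlgebraic ℚ (b i)) → (∀ i, 0 < b i) →
      (∀ i, IsAlgebraic ℚ (β i)) →
      LinearIndependent ℚ (Sum.elim (fun i => ((Real.log (b i) : ℝ) : ℂ))
        (fun i => Complex.I * ((Real.arctan (β i) : ℝ) : ℂ)) : Fin p ⊕ Fin q → ℂ) →
      ∀ μ : Unit ⊕ (Fin p ⊕ Fin q) → ℝ, (∀ j, IsAlgebraic ℚ (μ j)) →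
        ∑ j, μ j * Sum.elim (fun _ => (1 : ℝ))
          (Sum.elim (fun i => Real.log (b i)) (fun i => Real.arctan (β i))) j = 0 →
        ∀ j, μ j = 0 := by
  intro p q b β hb hpos hβ hli μ hμ hsum
  have halg : ∀ i, IsAlgebraic ℚ (Complex.exp (Sum.elim (fun i => ((Real.log (b i) : ℝ) : ℂ))
      (fun i => Complex.I * ((Real.arctan (β i) : ℝ) : ℂ)) i)) := by
    rintro (i | k)
    · exact toric_isAlgebraic_cexp_log (hb i) (hpos i)
    · exact toric_isAlgebraic_cexp_I_mul_arctan (hβ k)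
  exact toric_eq_zero_of_linearIndependent (fun i => Real.log (b i)) (fun i => Real.arctan (β i))
    (baker_holds _ halg hli) μ hμ hsum

end Summit.KontsevichZagierPeriods.SymplecticScissors.MordellWeil

end
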